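import Summits.KontsevichZagierPeriods.KontsevichZagierPeriods.Theorems.HurwitzMicroSectorsNormalFormPrincipleLevelOne
import Summits.KontsevichZagierPeriods.KontsevichZagierPeriods.Theorems.HurwitzMicroSectorsNormalFormPrincipleSlabASubPtK20
import Summits.KontsevichZagierPeriods.KontsevichZagierPeriods.Theorems.HurwitzMicroSectorsNormalFormPrincipleAlgCarriers
import Summits.KontsevichZagierPeriods.KontsevichZagierPeriods.Theorems.HurwitzMicroSectorsNormalFormPrincipleM2FiveZetaTwo
import Literature.NumberTheory.Transcendental.BoxIntegralZetaValues

/-!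
# `NormalFormPrinciple` (stmt-KontsevichZagierPeriods-3869), line `SketchIdeator1` — leaf `stub_boxRigidity`:
# the even zeta values layer: the constant box, the monomial box and the zeta box exist

Registered sub-goal `exists_boxes` of the layer `EvenZeta` (diagonal level-one boxes of even
weight). For a real algebraic coefficient `c` (`IsAlgebraic ℚ c`) the three shapes of
Kontsevich–Zagier integral representations met along the even-zeta pipeline exist in every
dimension `w`, with LITERAL domains (the open unit box `{x : Fin w → ℝ | ∀ i, x i ∈ (0,1)}`, for
`w = 0` the point) and integrands:

* the constant box `[(0,1)ʷ, c]` (all `w`): the constant `c` is `ℚ`-semialgebraic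
  (`isSemialgebraicFunOn_const_of_isAlgebraic`) and continuous, hence integrable on the compact
  cube `[0,1]ʷ ⊇ (0,1)ʷ`;
* the monomial box `[(0,1)ʷ, c·(x₀⋯x_{w−1})ⁱ]` (all `w, i`): algebraic constant times a
  `ℚ`-polynomial (product rule), continuous on `[0,1]ʷ`;
* the zeta box `[(0,1)ʷ, c·(x₀⋯x_{w−1})ᵐ/(1 − x₀⋯x_{w−1})]` (`w ≥ 2`): algebraic constant times a
  quotient of `ℚ`-polynomials whose denominator is positive on the open box (`∏ xₗ < 1`,
  `BoxIntegral.prod_mem_Ioo`); absolute convergence by domination `|c·pᵐ/(1 − p)| ≤ |c|/(1 − p)`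
  (`p = ∏ xₗ ∈ (0,1)`) and the `ζ(w)` box integral
  (`BoxIntegral.integrableOn_box_one_div_one_sub_prod`, `w ≥ 2`; for `w ≤ 1` it diverges).

References: M. Kontsevich, D. Zagier, *Periods* (2001), §1.1–1.2; F. Beukers, *A note on the
irrationality of ζ(2) and ζ(3)*, Bull. LMS 11 (1979). No new definitions.
-/

noncomputable section

open MeasureTheory Set
open Literature.NumberTheory.Transcendental Literature.NumberTheory.Transcendental.KZ
open Literature.ModelTheory.ExponentialFields (IsSemialgebraic)

namespace Summit.KontsevichZagierPeriods.HurwitzMicroSectors.NormalFormPrinciple.PiBox.EvenZeta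

/-! ## The constant box -/

/-- **The constant box with an algebraic coefficient exists** (any dimension `w`; for `w = 0` the
domain is the point `univ ⊆ ℝ⁰`): `[(0,1)ʷ, c]` is an integral representation for real algebraic
`c` — the constant is `ℚ`-semialgebraic and integrable on the compact cube `[0,1]ʷ ⊇ (0,1)ʷ`.
[cite: KontsevichZagier2001, §1.1] -/
theorem ez_exists_constBox (w : ℕ) {c : ℝ} (hc : IsAlgebraic ℚ c) :
    ∃ N : IntegralRep w, N.domain = {x | ∀ i, x i ∈ Set.Ioo (0:ℝ) 1} ∧
      N.integrand = fun _ => c := by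
  have hB := isSemialgebraic_box w
  have hcont : Continuous fun _ : Fin w → ℝ => c := continuous_const
  have hint : IntegrableOn (fun _ : Fin w → ℝ => c) {x | ∀ i, x i ∈ Set.Ioo (0:ℝ) 1} :=
    (hcont.integrableOn_Icc (a := 0) (b := 1)).mono_set
      fun _ hx => ⟨fun i => (hx i).1.le, fun i => (hx i).2.le⟩
  exact ⟨⟨_, _, hB, isSemialgebraicFunOn_const_of_isAlgebraic hB hc, hint⟩, rfl, rfl⟩

/-! ## The monomial box -/

/-- **Semialgebraicity of the diagonal monomial integrand with an algebraic coefficient**: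
`x ↦ c·(x₀⋯x_{w−1})ⁱ` is the algebraic constant `c` times a `ℚ`-polynomial, hence
`ℚ`-semialgebraic on the open unit box. [cite: KontsevichZagier2001, §1.1] -/
theorem ez_isSemialgebraicFunOn_monomialBoxIntegrand (w i : ℕ) {c : ℝ} (hc : IsAlgebraic ℚ c) :
    IsSemialgebraicFunOn ℚ {x : Fin w → ℝ | ∀ i, x i ∈ Set.Ioo (0:ℝ) 1}
      (fun x => c * (∏ l, x l) ^ i) := by
  have hB := isSemialgebraic_box w
  refine (IsSemialgebraicFunOn.mul_holds (isSemialgebraicFunOn_const_of_isAlgebraic hB hc)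
    (isSemialgebraicFunOn_aeval hB ((∏ l, MvPolynomial.X l) ^ i))).congr fun x _ => ?_
  simp only [Pi.mul_apply, map_pow, map_prod, MvPolynomial.aeval_X]

/-- **The diagonal monomial box with an algebraic coefficient exists** (any `w, i`):
`[(0,1)ʷ, c·(x₀⋯x_{w−1})ⁱ]` is an integral representation for real algebraic `c` (polynomial
integrand, continuous on the compact cube `[0,1]ʷ ⊇ (0,1)ʷ`). [cite: KontsevichZagier2001, §1.1] -/
theorem ez_exists_monomialBox (w i : ℕ) {c : ℝ} (hc : IsAlgebraic ℚ c) :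
    ∃ N : IntegralRep w, N.domain = {x | ∀ i, x i ∈ Set.Ioo (0:ℝ) 1} ∧
      N.integrand = fun x => c * (∏ l, x l) ^ i := by
  have hcont : Continuous fun x : Fin w → ℝ => c * (∏ l, x l) ^ i :=
    continuous_const.mul ((continuous_finsetProd _ fun l _ => continuous_apply l).pow i)
  have hint : IntegrableOn (fun x : Fin w → ℝ => c * (∏ l, x l) ^ i)
      {x | ∀ i, x i ∈ Set.Ioo (0:ℝ) 1} :=
    (hcont.integrableOn_Icc (a := 0) (b := 1)).mono_set
      fun _ hx => ⟨fun i => (hx i).1.le, fun i => (hx i).2.le⟩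
  exact ⟨⟨_, _, isSemialgebraic_box w, ez_isSemialgebraicFunOn_monomialBoxIntegrand w i hc, hint⟩,
    rfl, rfl⟩

/-! ## The zeta box -/

/-- **Semialgebraicity of the zeta-box integrand with an algebraic coefficient** (`w ≥ 1`):
`x ↦ c·(x₀⋯x_{w−1})ᵐ/(1 − x₀⋯x_{w−1})` is the algebraic constant `c` times a quotient of
`ℚ`-polynomials whose denominator is positive on the open unit box (`∏ xₗ < 1`).
[cite: KontsevichZagier2001, §1.1] -/
theorem ez_isSemialgebraicFunOn_zetaBoxIntegrand {w : ℕ} (hw : w ≠ 0) (m : ℕ) {c : ℝ}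
    (hc : IsAlgebraic ℚ c) :
    IsSemialgebraicFunOn ℚ {x : Fin w → ℝ | ∀ i, x i ∈ Set.Ioo (0:ℝ) 1}
      (fun x => c * (∏ l, x l) ^ m / (1 - ∏ l, x l)) := by
  have hB := isSemialgebraic_box w
  refine (IsSemialgebraicFunOn.mul_holds (isSemialgebraicFunOn_const_of_isAlgebraic hB hc)
    (isSemialgebraicFunOn_aeval_div_aeval hB ((∏ l, MvPolynomial.X l) ^ m)
      (1 - ∏ l, MvPolynomial.X l) fun x hx => ?_)).congr fun x _ => ?_
  · simp only [map_sub, map_one, map_prod, MvPolynomial.aeval_X]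
    exact (sub_pos.2 (BoxIntegral.prod_mem_Ioo hw hx).2).ne'
  · simp only [Pi.mul_apply, map_pow, map_sub, map_one, map_prod, MvPolynomial.aeval_X]
    ring

/-- **Absolute convergence of the zeta-box integrand** (`w ≥ 2`, any real `c`): on the open box
`p = ∏ xₗ ∈ (0,1)`, so `|c·pᵐ/(1 − p)| ≤ |c|/(1 − p)`, and `1/(1 − p)` is integrable on the open
unit box by the `ζ(w)` box integral (`BoxIntegral.integrableOn_box_one_div_one_sub_prod`).
[cite: KontsevichZagier2001, §1.1] -/
theorem ez_integrableOn_zetaBoxIntegrand {w : ℕ} (hw : 2 ≤ w) (m : ℕ) (c : ℝ) :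
    IntegrableOn (fun x : Fin w → ℝ => c * (∏ l, x l) ^ m / (1 - ∏ l, x l))
      {x | ∀ i, x i ∈ Set.Ioo (0:ℝ) 1} := by
  refine Integrable.mono' ((BoxIntegral.integrableOn_box_one_div_one_sub_prod hw).const_mul |c|)
    (Measurable.aestronglyMeasurable (by fun_prop))
    (ae_restrict_of_forall_mem (Beukers.measurableSet_cube w) fun x hx => ?_)
  have hp := BoxIntegral.prod_mem_Ioo (by omega) hx
  have hD : (0:ℝ) < 1 - ∏ l, x l := sub_pos.2 hp.2
  have hM0 : 0 ≤ (∏ l, x l) ^ m := pow_nonneg hp.1.le m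
  have hM1 : (∏ l, x l) ^ m ≤ 1 := pow_le_one₀ hp.1.le hp.2.le
  rw [Real.norm_eq_abs, abs_div, abs_mul, abs_of_pos hD, abs_of_nonneg hM0, mul_div_assoc]
  exact mul_le_mul_of_nonneg_left (div_le_div_of_nonneg_right hM1 hD.le) (abs_nonneg c)

/-! ## The registered sub-goal -/

/-- **Stub Z3 (existence; registered sub-goal `exists_boxes` of stmt-KontsevichZagierPeriods-3869).**
For a real algebraic coefficient `c`: (1) the constant box `[(0,1)ʷ, c]` (all `w`, including the
point `w = 0`), (2) the diagonal monomial box `[(0,1)ʷ, c·(x₀⋯x_{w−1})ⁱ]` (all `w, i`) and (3) the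
zeta box `[(0,1)ʷ, c·(x₀⋯x_{w−1})ᵐ/(1 − x₀⋯x_{w−1})]` (`w ≥ 2`) exist as integral representations
of the Kontsevich–Zagier calculus, with literally these domains and integrands.
[cite: KontsevichZagier2001, §1.2] -/
theorem exists_boxes (c : ℝ) (hc : IsAlgebraic ℚ c) :
    (∀ (w : ℕ), ∃ N : IntegralRep w, N.domain = {x | ∀ i, x i ∈ Set.Ioo (0:ℝ) 1} ∧
      N.integrand = fun _ => c) ∧
    (∀ (w i : ℕ), ∃ N : IntegralRep w, N.domain = {x | ∀ i, x i ∈ Set.Ioo (0:ℝ) 1} ∧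
      N.integrand = fun x => c * (∏ l, x l) ^ i) ∧
    (∀ (w m : ℕ), 2 ≤ w → ∃ N : IntegralRep w, N.domain = {x | ∀ i, x i ∈ Set.Ioo (0:ℝ) 1} ∧
      N.integrand = fun x => c * (∏ l, x l) ^ m / (1 - ∏ l, x l)) := by
  refine ⟨fun w => ez_exists_constBox w hc, fun w i => ez_exists_monomialBox w i hc,
    fun w m hw => ?_⟩
  exact ⟨⟨_, _, isSemialgebraic_box w, ez_isSemialgebraicFunOn_zetaBoxIntegrand (by omega) m hc,
    ez_integrableOn_zetaBoxIntegrand hw m c⟩, rfl, rfl⟩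

end Summit.KontsevichZagierPeriods.HurwitzMicroSectors.NormalFormPrinciple.PiBox.EvenZeta
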